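import Mathlib.Analysis.InnerProductSpace.Calculus
import Mathlib.Analysis.InnerProductSpace.PiL2
import Mathlib.Analysis.SpecialFunctions.Sqrt
import Mathlib.Analysis.Calculus.Deriv.Inv
import HarnessLib

/-!
# Radial calculus on `ℝⁿ ∖ {0}`: the unit radial field and the tangential projection

Analysis support file (everything proved; two definitions, no named facts) for the cylindrical
coordinates of A. Waldron, *Long-time existence for Yang–Mills flow*, Invent. math. 217 (2019),
§4, done extrinsically: with `r = ‖x‖`, `ν = x/r` and the orthogonal projection `P_x` onto
`x^⊥ = T_xS_r`, tangential (g-valued) forms on the spheres are ambient multilinear maps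
precomposed with `P`, the Levi-Civita derivative of the spheres is `P ∘ D ∘ P`, and all the
curvature terms of `S_r` come from the derivatives of `ν` and `P` recorded here:

* `radialUnit`, `hasFDerivAt_radialUnit` — `ν(x) = x/‖x‖`, `Dν(x)u = P_x u/‖x‖`;
* `tangentialProj x : E →L[ℝ] E` — `P_x v = v − (⟨x,v⟩/‖x‖²) x`, with `tangentialProj_apply_self`
  (`P x = 0`), `inner_tangentialProj_left_self` (`⟨P v, x⟩ = 0`), `tangentialProj_eq_self`
  (`P v = v` for `v ⊥ x`), `tangentialProj_idem`, `inner_tangentialProj_comm` (self-adjoint),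
  `inner_tangentialProj` (`⟨P v, w⟩ = ⟨v, w⟩ − ⟨x,v⟩⟨x,w⟩/‖x‖²`);
* `hasFDerivAt_tangentialProj_apply` — `D(P·v)(x)u = −(⟨x,v⟩ P_x u + ⟨P_x u, v⟩ x)/‖x‖²`.

References: A. Waldron, Invent. math. 217 (2019), §4.1–4.2 [Waldron2019]; (submanifold
geometry of round spheres) [folklore].
-/

noncomputable section

open scoped RealInnerProductSpace Topology

namespace Literature.Analysis.Calculus

variable {E : Type*} [NormedAddCommGroup E] [InnerProductSpace ℝ E]

/-- **The derivative of the norm away from the origin**: `D‖·‖(x) = ⟨x, ·⟩/‖x‖` (a local copy of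
a standard fact, cf. `Literature.Geometry.Lorentzian.hasFDerivAt_norm_of_ne_zero`). [folklore] -/
private theorem hasFDerivAt_norm_of_ne_zero' {x : E} (hx : x ≠ 0) :
    HasFDerivAt (fun y : E => ‖y‖) (‖x‖⁻¹ • innerSL ℝ x) x := by
  have hpos : 0 < ‖x‖ := norm_pos_iff.2 hx
  have h1 : HasFDerivAt (fun y : E => ‖y‖ ^ 2) (2 • innerSL ℝ x) x :=
    (hasStrictFDerivAt_norm_sq x).hasFDerivAt
  have h2 := h1.sqrt (pow_ne_zero 2 hpos.ne')
  have heq : (fun y : E => Real.sqrt (‖y‖ ^ 2)) = fun y => ‖y‖ :=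
    funext fun y => Real.sqrt_sq (norm_nonneg y)
  rw [heq] at h2
  refine h2.congr_fderiv ?_
  ext u
  simp only [FunLike.coe_smul, Pi.smul_apply, innerSL_apply_apply, smul_eq_mul,
    nsmul_eq_mul, Nat.cast_ofNat, Pi.mul_apply, Pi.ofNat_apply, Real.sqrt_sq hpos.le]
  field_simp

/-- **The unit radial field** `ν(x) = x/‖x‖`. [folklore] -/
def radialUnit (x : E) : E := ‖x‖⁻¹ • x

/-- Unfolding lemma. [folklore] -/
theorem radialUnit_def (x : E) : radialUnit x = ‖x‖⁻¹ • x := rfl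

/-- `‖ν(x)‖ = 1` for `x ≠ 0`. [folklore] -/
theorem norm_radialUnit {x : E} (hx : x ≠ 0) : ‖radialUnit x‖ = 1 := by
  rw [radialUnit, norm_smul, norm_inv, norm_norm, inv_mul_cancel₀ (norm_ne_zero_iff.2 hx)]

/-- **The tangential projection** `P_x v = v − (⟨x, v⟩/‖x‖²) x`, the orthogonal projection onto
`x^⊥` (the tangent space of the sphere through `x`); for `x = 0` it is the identity. [folklore] -/
def tangentialProj (x : E) : E →L[ℝ] E :=
  ContinuousLinearMap.id ℝ E - (‖x‖ ^ 2)⁻¹ • (innerSL ℝ x).smulRight x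

/-- The formula for `tangentialProj`. [folklore] -/
theorem tangentialProj_apply (x v : E) :
    tangentialProj x v = v - ((‖x‖ ^ 2)⁻¹ * ⟪x, v⟫) • x := by
  simp [tangentialProj, smul_smul]

/-- `P_x x = 0`. [folklore] -/
theorem tangentialProj_apply_self (x : E) : tangentialProj x x = 0 := by
  rw [tangentialProj_apply, real_inner_self_eq_norm_sq]
  by_cases hx : x = 0
  · simp [hx]
  · rw [inv_mul_cancel₀ (pow_ne_zero 2 (norm_ne_zero_iff.2 hx)), one_smul, sub_self]

/-- `⟨P_x v, x⟩ = 0`: the projection is tangential. [folklore] -/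
theorem inner_tangentialProj_left_self (x v : E) : ⟪tangentialProj x v, x⟫ = 0 := by
  rw [tangentialProj_apply, inner_sub_left, inner_smul_left, real_inner_self_eq_norm_sq,
    real_inner_comm x v]
  by_cases hx : x = 0
  · simp [hx]
  · have h : ‖x‖ ^ 2 ≠ 0 := pow_ne_zero 2 (norm_ne_zero_iff.2 hx)
    simp only [RCLike.conj_to_real]
    field_simp
    ring

/-- `P_x v = v` for `v ⊥ x`. [folklore] -/
theorem tangentialProj_eq_self {x v : E} (hv : ⟪x, v⟫ = 0) : tangentialProj x v = v := by
  rw [tangentialProj_apply, hv, mul_zero, zero_smul, sub_zero]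

/-- `⟨P_x v, w⟩ = ⟨v, w⟩ − ⟨x, v⟩⟨x, w⟩/‖x‖²`. [folklore] -/
theorem inner_tangentialProj (x v w : E) :
    ⟪tangentialProj x v, w⟫ = ⟪v, w⟫ - (‖x‖ ^ 2)⁻¹ * ⟪x, v⟫ * ⟪x, w⟫ := by
  rw [tangentialProj_apply, inner_sub_left, inner_smul_left]
  simp only [RCLike.conj_to_real]

/-- The projection is self-adjoint: `⟨P_x v, w⟩ = ⟨v, P_x w⟩`. [folklore] -/
theorem inner_tangentialProj_comm (x v w : E) :
    ⟪tangentialProj x v, w⟫ = ⟪v, tangentialProj x w⟫ := by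
  rw [inner_tangentialProj, real_inner_comm (tangentialProj x w) v, inner_tangentialProj,
    real_inner_comm v w]
  ring

/-- The projection is idempotent. [folklore] -/
theorem tangentialProj_idem (x v : E) :
    tangentialProj x (tangentialProj x v) = tangentialProj x v :=
  tangentialProj_eq_self (by rw [real_inner_comm]; exact inner_tangentialProj_left_self x v)

/-- **The derivative of the unit radial field**: `Dν(x)u = P_x u/‖x‖` (`x ≠ 0`). [folklore] -/
theorem hasFDerivAt_radialUnit {x : E} (hx : x ≠ 0) :
    HasFDerivAt (radialUnit (E := E)) (‖x‖⁻¹ • tangentialProj x) x := by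
  have hpos : 0 < ‖x‖ := norm_pos_iff.2 hx
  have hn := hasFDerivAt_norm_of_ne_zero' hx
  have hinv : HasFDerivAt (fun y : E => ‖y‖⁻¹) (-(‖x‖ ^ 2)⁻¹ • (‖x‖⁻¹ • innerSL ℝ x)) x := by
    exact (hasDerivAt_inv hpos.ne').comp_hasFDerivAt x hn
  have h : HasFDerivAt (fun y : E => ‖y‖⁻¹ • y)
      (‖x‖⁻¹ • ContinuousLinearMap.id ℝ E +
        (-(‖x‖ ^ 2)⁻¹ • (‖x‖⁻¹ • innerSL ℝ x)).smulRight x) x :=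
    hinv.smul (hasFDerivAt_id x)
  refine h.congr_fderiv ?_
  ext u
  simp only [FunLike.coe_add, Pi.add_apply, FunLike.coe_smul,
    Pi.smul_apply, ContinuousLinearMap.smulRight_apply, FunLike.coe_neg,
    Pi.neg_apply, innerSL_apply_apply, ContinuousLinearMap.id_apply, tangentialProj_apply,
    smul_sub, smul_smul, smul_eq_mul, neg_mul, neg_smul]
  module

/-- **The derivative of the tangential projection applied to a fixed vector** (`x ≠ 0`):
`D(y ↦ P_y v)(x) u = −(⟨x, v⟩ P_x u + ⟨P_x u, v⟩ x)/‖x‖²` (for `u ⊥ x`: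
`−(⟨x,v⟩u + ⟨u,v⟩x)/‖x‖²`, i.e. `∂_uP = −(∂_uν) ⊗ ν − ν ⊗ ∂_uν`). [folklore] -/
theorem hasFDerivAt_tangentialProj_apply {x : E} (hx : x ≠ 0) (v : E) :
    HasFDerivAt (fun y => tangentialProj y v)
      (-(‖x‖ ^ 2)⁻¹ • (⟪x, v⟫ • tangentialProj x + (innerSL ℝ (tangentialProj x v)).smulRight x))
      x := by
  have hpos : 0 < ‖x‖ := norm_pos_iff.2 hx
  have h2 : ‖x‖ ^ 2 ≠ 0 := pow_ne_zero 2 hpos.ne'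
  -- `y ↦ (‖y‖²)⁻¹`, `y ↦ ⟨y, v⟩`, and their product times `y`
  have hsq : HasFDerivAt (fun y : E => ‖y‖ ^ 2) (2 • innerSL ℝ x) x :=
    (hasStrictFDerivAt_norm_sq x).hasFDerivAt
  have hinv : HasFDerivAt (fun y : E => (‖y‖ ^ 2)⁻¹) (-((‖x‖ ^ 2) ^ 2)⁻¹ • (2 • innerSL ℝ x)) x := by
    exact (hasDerivAt_inv h2).comp_hasFDerivAt x hsq
  have hin : HasFDerivAt (fun y : E => ⟪y, v⟫) (innerSL ℝ v) x := by
    have h := (innerSL ℝ v).hasFDerivAt (x := x)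
    refine h.congr_of_eventuallyEq (Filter.Eventually.of_forall fun y => ?_)
    simp [real_inner_comm]
  have hcoef : HasFDerivAt (fun y : E => (‖y‖ ^ 2)⁻¹ * ⟪y, v⟫)
      ((‖x‖ ^ 2)⁻¹ • innerSL ℝ v + ⟪x, v⟫ • (-((‖x‖ ^ 2) ^ 2)⁻¹ • (2 • innerSL ℝ x))) x :=
    hinv.mul hin
  have hprod := hcoef.smul (hasFDerivAt_id x)
  have hP : HasFDerivAt (fun y => tangentialProj y v)
      ((0 : E →L[ℝ] E) - (((‖x‖ ^ 2)⁻¹ * ⟪x, v⟫) • ContinuousLinearMap.id ℝ E +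
        ((‖x‖ ^ 2)⁻¹ • innerSL ℝ v + ⟪x, v⟫ • (-((‖x‖ ^ 2) ^ 2)⁻¹ • (2 • innerSL ℝ x))).smulRight
          x)) x := by
    have h : HasFDerivAt (fun y : E => v - ((‖y‖ ^ 2)⁻¹ * ⟪y, v⟫) • y)
        ((0 : E →L[ℝ] E) - (((‖x‖ ^ 2)⁻¹ * ⟪x, v⟫) • ContinuousLinearMap.id ℝ E +
        ((‖x‖ ^ 2)⁻¹ • innerSL ℝ v + ⟪x, v⟫ • (-((‖x‖ ^ 2) ^ 2)⁻¹ • (2 • innerSL ℝ x))).smulRight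
          x)) x := (hasFDerivAt_const v x).sub hprod
    refine h.congr_of_eventuallyEq (Filter.Eventually.of_forall fun y => ?_)
    simp only [tangentialProj_apply]
  refine hP.congr_fderiv ?_
  ext u
  simp only [FunLike.coe_sub, Pi.sub_apply,
    FunLike.coe_add, Pi.add_apply, FunLike.coe_smul, Pi.smul_apply,
    ContinuousLinearMap.id_apply, ContinuousLinearMap.smulRight_apply, FunLike.coe_neg,
    Pi.neg_apply, innerSL_apply_apply, tangentialProj_apply, smul_sub, smul_smul, add_smul, sub_smul,
    smul_add, neg_smul, zero_sub, smul_eq_mul, nsmul_eq_mul, Nat.cast_ofNat, neg_mul, map_smul,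
    map_sub, Pi.mul_apply, Pi.ofNat_apply]
  rw [real_inner_comm u v]
  match_scalars <;> field_simp
  ring

end Literature.Analysis.Calculus
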